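import Summits.QuantumAdvantage.QuantumAdvantage.Theorems.NearExactIsExact.Negative.SkewProductCore

/-!
# `NearExactIsExact` (stmt-QuantumAdvantage-14043) — negative lemma: the FLAT CHAIN and THEOREM K3-INV
  (gen 45 disprover; every K-model over a 3-bit base whose fibre pencil consists of involutions is
  empty, one-sidedly, census-free — the first theorem INSIDE the `naff = 3` stratum of BQ-11, the
  stratum left open by THEOREM K4 / `ReflectedQuad`)

A K-MODEL OVER A 3-BIT BASE is `π(ū, s) = (ū, p(ū) ⊕ K(ū)s)` on `𝔽₂^{3+m}` (`ū ∈ 𝔽₂³`, `p` arbitrary,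
`K(ū)` additive in `s`, `K(0̄) = id`); its residual for the BQ problem is `{0̄} × A` with `A ⊆ 𝔽₂^m` a flat
of codimension `3` (mass `2^{(3+m)-6}`).  Two-sided K-models are exactly those with `ū ↦ K(ū)⁻¹` affine;
the main family (modules over `𝔽₂[a,b,c]/(a²,b²,c²)`, used by all `naff = 4, 5` constructions of the cell)
has every `K(ū)` an INVOLUTION, and then automatically `Π_{ū ≠ 0} K(ū) = id` (the pencil is commuting
square-zero, and the degree-1..3 parts of `Π_{ū≠0}(1 + ℓ_ū)` in `𝔽₂[a,b,c]/(a²,b²,c²)` cancel in pairs).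

**FLAT CHAIN (`flat_chain`, any `n`, any `π`, any length).** `c₁ ⊕ c₂∘π = U` with `c₁, c₂` cubic.  Let
`σ_j, ρ_j : 𝔽₂³ → 𝔽₂ⁿ` (`j ∈ ℤ/L`) be 3-flats with `ρ_j` and `π∘ρ_j` affine, `σ_j = ρ_j ⊕ d_j` (same
directions) and `π∘σ_j = π∘ρ_{γ j} ⊕ e_j` for a permutation `γ`.  Then the total `U`-mass of the `2L` flats
is even: `c₁∘σ_j ⊕ c₁∘ρ_j = (Δ_{d_j}c₁)∘ρ_j` and `c₂∘π∘σ_j ⊕ c₂∘π∘ρ_{γj} = (Δ_{e_j}c₂)∘(π∘ρ_{γ j})` are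
quadratics on `3` bits, of even weight (Ax at `(3,2)`).  (Cubics do NOT vanish on 3-flats; only these
matched differences do — this is the dual certificate of the top trilinear level of the residual equation.)

**THEOREM K3-INV (`kthree_inv_empty`).** Source `𝔽₂^{3+m}`, `π(ū,s) = (ū, p(ū) ⊕ K(ū)s)` with `K(ū)`
additive involutions, `K(0̄) = id`, and `K(w₆)∘⋯∘K(w₀) = id` for some nonzero `w₀..w₆` (for an involution
pencil: any enumeration of `𝔽₂³ ∖ 0`); residual `[ū = 0̄]·V(s)` where `V` has odd parity on some 3-space
`⟨a,b,c⟩` through `0` (every codimension-3 flat `A` does).  Then there is no cubic pair — for EVERY `p`.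
Proof: `T_V(a,b,c) := Σ_{v ∈ 𝔽₂³} V(v·(a,b,c))`.  If some `K(ū)` moves `T`, the chain of length `2`
(`{ū}×⟨τ⟩, {ū}×⟨Kτ⟩` against `{0̄}×⟨τ⟩, {0̄}×⟨Kτ⟩`) has odd mass `T(τ) + T(Kτ) = 1`; otherwise the chain of
length `7` along the relation (`{w_j} × ⟨τ_j⟩`, `τ_{j+1} = K(w_j)τ_j`, `τ₇ = τ₀`) has mass `7·T(τ₀) = 1`.

Exact numerics (folder `k3/` of the gen-45 disprover): the top trilinear condition fails for all 372
monomial/dual module pencils and 300 + 300 random module quotients/submodules at `m = 8`, as the theorem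
says; it is provably unsatisfiable for every invertible pencil at `m ≤ 5`, but SATISFIABLE one-sidedly at
`m = 7` by a commutative invertible NON-involution pencil (so the involution hypothesis is load-bearing for
this certificate; that pencil is not inversion-affine, hence not two-sided).

HONEST FRAMING: a kernel-checked negative lemma closing the involution (module) sub-family of the thin
algebraic end (`K`-models over the 3-bit base) of the open `naff = 3` stratum of BQ-11; general `naff = 3`
maps, and K3-models with non-involutive inversion-affine pencils, are NOT covered; NOT summit progress.
-/

set_option linter.dupNamespace false -- D-0017: single-problem summit ⇒ `QuantumAdvantage.QuantumAdvantage` by design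

namespace Summit.QuantumAdvantage.QuantumAdvantage.Theorems.NearExactIsExact.Negative.KThreeInvolution

open Finset
open Literature.Computability.QuantumComplexity
open Literature.Computability.QuantumComplexity.BuzetChailloux (bxor)
open Summit.QuantumAdvantage.QuantumAdvantage.Theorems.CubicForrelation.NearExactIsExact
  (fc_isDegLeFun_comp fc_sum_signOf_eq_card stub_axParity stub_derivDegree bb_isDegLeFun_bxor)
open Summit.QuantumAdvantage.QuantumAdvantage.Theorems.SignedCubicForrelationNotPrBPP (knf_isDegLeFun_ip)
open Summit.QuantumAdvantage.QuantumAdvantage.Theorems.NearExactIsExact.Negative.BqqSeven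
  (natCast_eq_zero_of_even)
open Summit.QuantumAdvantage.QuantumAdvantage.Theorems.NearExactIsExact.Negative.SkewProductCore

/-! ### Ax at `(3, 2)` -/

/-- Ax / McEliece at `n = 3`, `d = 2`: a quadratic Boolean function on `3` bits has even weight.
[folklore] -/
theorem even_card_of_deg_two {F : (Fin 3 → Bool) → Bool} (hF : IsDegLeFun 2 F) :
    Even ((univ.filter fun x : Fin 3 → Bool => F x = true).card) := by
  obtain ⟨z, hz⟩ := stub_axParity 3 2 F univ (by norm_num) hF
  rw [filter_true_of_mem (fun u _ i _ => mem_univ i), card_fin, fc_sum_signOf_eq_card] at hz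
  have h4 : (2 : ℝ) ^ ((3 + 2 - 1) / 2) = 4 := by norm_num
  rw [h4] at hz
  have hc : (((univ.filter fun x : Fin 3 → Bool => F x = true).card : ℤ) : ℝ) =
      ((2 * (2 - z) : ℤ) : ℝ) := by
    push_cast
    linear_combination (-(1 : ℝ) / 2) * hz
  have he : Even (((univ.filter fun x : Fin 3 → Bool => F x = true).card : ℤ)) :=
    ⟨2 - z, by rw [Int.cast_injective hc]; ring⟩
  exact (Int.even_coe_nat _).mp he

/-- Degree `≤ 2` on `3` bits ⇒ `Σ_x ind (F x) = 0`. [folklore] -/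
theorem sum_ind_eq_zero_of_deg_two {F : (Fin 3 → Bool) → Bool} (hF : IsDegLeFun 2 F) :
    ∑ x, ind (F x) = 0 := by
  rw [sum_ind]
  exact natCast_eq_zero_of_even (even_card_of_deg_two hF)

/-! ### The flat chain -/

/-- **FLAT CHAIN.** `c₁ ⊕ c₂∘π = U`, `c₁, c₂` cubic; 3-flats `σ_j = ρ_j ⊕ d_j` with `ρ_j`, `π∘ρ_j` affine
and `π∘σ_j = π∘ρ_{γ j} ⊕ e_j` for a permutation `γ` of the index set ⇒ the total `U`-mass of all `σ_j, ρ_j`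
is even. [folklore] -/
theorem flat_chain {n : ℕ} {ι : Type*} [Fintype ι] (π : (Fin n → Bool) → (Fin n → Bool))
    (c₁ c₂ : (Fin n → Bool) → Bool) (h₁ : IsDegLeFun 3 c₁) (h₂ : IsDegLeFun 3 c₂)
    (U : (Fin n → Bool) → Bool) (hres : ∀ z, (c₁ z ^^ c₂ (π z)) = U z)
    (σ ρ : ι → (Fin 3 → Bool) → (Fin n → Bool)) (hρ : ∀ j i, IsDegLeFun 1 (fun v => ρ j v i))
    (hπρ : ∀ j i, IsDegLeFun 1 (fun v => π (ρ j v) i)) (γ : ι ≃ ι) (d e : ι → Fin n → Bool)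
    (hd : ∀ j v, σ j v = bxor (ρ j v) (d j)) (he : ∀ j v, π (σ j v) = bxor (π (ρ (γ j) v)) (e j)) :
    ∑ j, ∑ v, (ind (U (σ j v)) + ind (U (ρ j v))) = 0 := by
  -- source side: `c₁∘σ_j ⊕ c₁∘ρ_j = (Δ_{d_j} c₁)∘ρ_j`, a quadratic on 3 bits
  have hA : ∀ j, ∑ v, (ind (c₁ (σ j v)) + ind (c₁ (ρ j v))) = 0 := by
    intro j
    have hdeg : IsDegLeFun 2 (fun v : Fin 3 → Bool => c₁ (ρ j v) ^^ c₁ (bxor (ρ j v) (d j))) :=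
      fc_isDegLeFun_comp (stub_derivDegree n 2 c₁ (d j) h₁) (ρ j) (hρ j) (by norm_num)
    rw [← sum_ind_eq_zero_of_deg_two hdeg]
    exact sum_congr rfl fun v _ => by rw [hd j v, ind_xor, add_comm]
  -- target side: `c₂∘π∘σ_j ⊕ c₂∘π∘ρ_{γ j} = (Δ_{e_j} c₂)∘(π∘ρ_{γ j})`, a quadratic on 3 bits
  have hB : ∀ j, ∑ v, (ind (c₂ (π (σ j v))) + ind (c₂ (π (ρ (γ j) v)))) = 0 := by
    intro j
    have hdeg : IsDegLeFun 2
        (fun v : Fin 3 → Bool => c₂ (π (ρ (γ j) v)) ^^ c₂ (bxor (π (ρ (γ j) v)) (e j))) :=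
      fc_isDegLeFun_comp (stub_derivDegree n 2 c₂ (e j) h₂) (fun v => π (ρ (γ j) v)) (hπρ (γ j))
        (by norm_num)
    rw [← sum_ind_eq_zero_of_deg_two hdeg]
    exact sum_congr rfl fun v _ => by rw [he j v, ind_xor, add_comm]
  have hpt : ∀ j v, ind (U (σ j v)) + ind (U (ρ j v)) =
      (ind (c₁ (σ j v)) + ind (c₁ (ρ j v))) + (ind (c₂ (π (σ j v))) + ind (c₂ (π (ρ j v)))) := by
    intro j v
    rw [← hres (σ j v), ← hres (ρ j v), ind_xor, ind_xor]
    ring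
  have hγ : ∑ j, ∑ v, ind (c₂ (π (ρ j v))) = ∑ j, ∑ v, ind (c₂ (π (ρ (γ j) v))) :=
    (Equiv.sum_comp γ (fun j => ∑ v, ind (c₂ (π (ρ j v))))).symm
  calc ∑ j, ∑ v, (ind (U (σ j v)) + ind (U (ρ j v)))
      = ∑ j, ∑ v, ((ind (c₁ (σ j v)) + ind (c₁ (ρ j v))) +
          (ind (c₂ (π (σ j v))) + ind (c₂ (π (ρ j v))))) :=
        sum_congr rfl fun j _ => sum_congr rfl fun v _ => hpt j v
    _ = ∑ j, ∑ v, (ind (c₁ (σ j v)) + ind (c₁ (ρ j v))) +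
          (∑ j, ∑ v, ind (c₂ (π (σ j v))) + ∑ j, ∑ v, ind (c₂ (π (ρ j v)))) := by
        simp only [sum_add_distrib]
    _ = ∑ j, ∑ v, (ind (c₁ (σ j v)) + ind (c₁ (ρ j v))) +
          ∑ j, ∑ v, (ind (c₂ (π (σ j v))) + ind (c₂ (π (ρ (γ j) v)))) := by
        rw [hγ]; simp only [sum_add_distrib]
    _ = 0 := by
        rw [sum_eq_zero fun j _ => hA j, sum_eq_zero fun j _ => hB j, add_zero]

/-! ### 3-flats through the origin of a fibre

The tree's idiom for parametrised flats is used: the point `ε ∈ 𝔽₂³` of the 3-flat through `0` with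
directions `a : Fin 3 → 𝔽₂^m` is `fun j => decide (Odd #{i | ε i ∧ a i j})` (`= ε₀a₀ ⊕ ε₁a₁ ⊕ ε₂a₂`), and
`T_V(a) := Σ_ε ind V(ε·a) ∈ 𝔽₂` is the parity of `V` on it (for `V` cubic: the value of its trilinear top
form; `T_V(a) = 1` for some `a` iff that form is nonzero, e.g. `V` the indicator of a codimension-3 flat). -/

/-- The explicit-xor form of a point of a 3-flat through `0`. [folklore] -/
theorem fp_eq_bxor {m : ℕ} (a : Fin 3 → Fin m → Bool) (ε : Fin 3 → Bool) :
    (fun j => decide (Odd #(univ.filter fun i => ε i && a i j))) =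
      bxor (bxor (fun j => ε 0 && a 0 j) (fun j => ε 1 && a 1 j)) (fun j => ε 2 && a 2 j) := by
  funext j
  rw [card_filter, Fin.sum_univ_three]
  show decide (Odd ((if (ε 0 && a 0 j) = true then 1 else 0) + (if (ε 1 && a 1 j) = true then 1 else 0) +
    (if (ε 2 && a 2 j) = true then 1 else 0))) = (((ε 0 && a 0 j) ^^ (ε 1 && a 1 j)) ^^ (ε 2 && a 2 j))
  cases (ε 0 && a 0 j) <;> cases (ε 1 && a 1 j) <;> cases (ε 2 && a 2 j) <;> decide

/-- Coordinates of `ε ↦ (ū, t ε)` with `ū` constant and `t` affine are affine. [folklore] -/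
theorem isDegLeFun_append_const {m : ℕ} (u : Fin 3 → Bool) (t : (Fin 3 → Bool) → Fin m → Bool)
    (ht : ∀ k, IsDegLeFun 1 (fun ε => t ε k)) :
    ∀ j : Fin (3 + m), IsDegLeFun 1 (fun ε : Fin 3 → Bool => Fin.append u (t ε) j) := by
  intro j
  induction j using Fin.addCases with
  | left i =>
    have e : (fun ε : Fin 3 → Bool => Fin.append u (t ε) (Fin.castAdd m i)) = fun _ => u i :=
      funext fun ε => Fin.append_left u _ i
    rw [e]; exact isDegLeFun_const 1 (u i)
  | right k =>
    have e : (fun ε : Fin 3 → Bool => Fin.append u (t ε) (Fin.natAdd 3 k)) = fun ε => t ε k :=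
      funext fun ε => Fin.append_right u _ k
    rw [e]; exact ht k

/-- `(ū, s) = (0̄, s) ⊕ (ū, 0)`. [folklore] -/
theorem append_eq_bxor {m : ℕ} (u : Fin 3 → Bool) (s : Fin m → Bool) :
    Fin.append u s = bxor (Fin.append (fun _ : Fin 3 => false) s) (Fin.append u (fun _ => false)) := by
  funext j
  induction j using Fin.addCases with
  | left i => simp [bxor]
  | right k => simp [bxor]

/-- `(ū, q ⊕ s) = (0̄, q₀ ⊕ s) ⊕ (ū, q ⊕ q₀)`. [folklore] -/
theorem append_bxor_eq {m : ℕ} (u : Fin 3 → Bool) (q q₀ s : Fin m → Bool) :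
    Fin.append u (bxor q s) =
      bxor (Fin.append (fun _ : Fin 3 => false) (bxor q₀ s)) (Fin.append u (bxor q q₀)) := by
  funext j
  induction j using Fin.addCases with
  | left i => simp [bxor]
  | right k =>
    simp only [bxor, Fin.append_right]
    cases q k <;> cases q₀ k <;> cases s k <;> rfl

/-- **K3 CHAIN.** `π(ū,s) = (ū, p(ū) ⊕ K(ū)s)` with `K(ū)` additive and `K(0̄) = id`, residual
`[ū = 0̄]·V(s)`, a cubic pair, nonzero base vectors `w₀..w_L` and direction triples `τ₀..τ_{L+1}` with
`τ_{k+1} = K(w_k)τ_k` and `τ_{L+1} = τ₀` ⇒ `Σ_{j ≤ L} T_V(τ_j) = 0` (the flat chain `{w_j} × ⟨τ_j⟩` against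
`{0̄} × ⟨τ_j⟩`: the former miss the residual, the latter weigh `T_V(τ_j)`). [folklore] -/
theorem kthree_chain {m : ℕ} (K : (Fin 3 → Bool) → (Fin m → Bool) → (Fin m → Bool))
    (hKadd : ∀ u s t, K u (bxor s t) = bxor (K u s) (K u t)) (hK0 : ∀ s, K (fun _ => false) s = s)
    (p : (Fin 3 → Bool) → (Fin m → Bool)) (π : (Fin (3 + m) → Bool) → (Fin (3 + m) → Bool))
    (hπ : ∀ u s, π (Fin.append u s) = Fin.append u (bxor (p u) (K u s)))
    (V : (Fin m → Bool) → Bool) (c₁ c₂ : (Fin (3 + m) → Bool) → Bool) (h₁ : IsDegLeFun 3 c₁)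
    (h₂ : IsDegLeFun 3 c₂)
    (hres : ∀ z, (c₁ z ^^ c₂ (π z)) =
      (decide (∀ i : Fin 3, z (Fin.castAdd m i) = false) && V (fun k => z (Fin.natAdd 3 k))))
    (L : ℕ) (w : ℕ → (Fin 3 → Bool)) (hw : ∀ k, k ≤ L → w k ≠ fun _ => false)
    (τ : ℕ → Fin 3 → Fin m → Bool) (hτ : ∀ k, k ≤ L → τ (k + 1) = fun i => K (w k) (τ k i))
    (hL : τ (L + 1) = τ 0) :
    ∑ j : Fin (L + 1), ∑ ε : Fin 3 → Bool,
      ind (V fun l => decide (Odd #(univ.filter fun i => ε i && τ j i l))) = 0 := by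
  -- additivity consequences
  have hK00 : ∀ u, K u (fun _ => false) = fun _ => false := by
    intro u
    have e : (fun _ : Fin m => false) = bxor (fun _ => false) (fun _ => false) :=
      funext fun i => by simp [bxor]
    have h := hKadd u (fun _ => false) (fun _ => false)
    rw [← e] at h
    rw [h]
    funext i; simp [bxor]
  have hKsmul : ∀ u (β : Bool) (x : Fin m → Bool), K u (fun i => β && x i) = fun i => β && K u x i := by
    intro u β x
    cases β
    · simp only [Bool.false_and]; exact hK00 u
    · simp only [Bool.true_and]
  have hKfp : ∀ u (a : Fin 3 → Fin m → Bool) (ε : Fin 3 → Bool),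
      K u (fun l => decide (Odd #(univ.filter fun i => ε i && a i l))) =
        fun l => decide (Odd #(univ.filter fun i => ε i && K u (a i) l)) := by
    intro u a ε
    rw [fp_eq_bxor, fp_eq_bxor (fun i => K u (a i)), hKadd, hKadd, hKsmul, hKsmul, hKsmul]
  -- index bookkeeping along the cycle `ℤ/(L+1)`
  have hidx : ∀ j : Fin (L + 1),
      τ ((finRotate (L + 1) j : Fin (L + 1)) : ℕ) = fun i => K (w j) (τ j i) := by
    intro j
    rw [coe_finRotate]
    split_ifs with hj
    · rw [hj, Fin.val_last, ← hL]
      exact hτ L le_rfl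
    · exact hτ j (Nat.lt_succ_iff.mp j.isLt)
  have key := flat_chain π c₁ c₂ h₁ h₂ _ hres
    (fun (j : Fin (L + 1)) ε => Fin.append (w j)
      (fun l => decide (Odd #(univ.filter fun i => ε i && τ j i l))))
    (fun (j : Fin (L + 1)) ε => Fin.append (fun _ => false)
      (fun l => decide (Odd #(univ.filter fun i => ε i && τ j i l))))
    (fun j => isDegLeFun_append_const _ _ fun l => knf_isDegLeFun_ip fun i => τ j i l)
    (by
      intro j i
      have e : (fun ε : Fin 3 → Bool => π (Fin.append (fun _ => false)
          (fun l => decide (Odd #(univ.filter fun i => ε i && τ j i l)))) i) =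
          fun ε => Fin.append (fun _ : Fin 3 => false) (bxor (p fun _ => false)
            (fun l => decide (Odd #(univ.filter fun i => ε i && τ j i l)))) i :=
        funext fun ε => by rw [hπ, hK0]
      rw [e]
      exact isDegLeFun_append_const _ _
        (fun l => bb_isDegLeFun_bxor (isDegLeFun_const 1 ((p fun _ => false) l))
          (knf_isDegLeFun_ip fun i => τ j i l)) i)
    (finRotate (L + 1)) (fun j => Fin.append (w j) (fun _ => false))
    (fun j => Fin.append (w j) (bxor (p (w j)) (p fun _ => false)))
    (fun j ε => append_eq_bxor _ _)
    (by
      intro j ε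
      rw [hπ, hπ, hK0, hKfp, hidx j]
      exact append_bxor_eq _ _ _ _)
  -- masses: the flats in the fibres `w_j ≠ 0̄` miss the residual, those in the fibre `0̄` weigh `T_V(τ_j)`
  rw [← key]
  refine sum_congr rfl fun j _ => ?_
  have hwj : ¬ ∀ i : Fin 3, w j i = false := fun h => hw j (Nat.lt_succ_iff.mp j.isLt) (funext h)
  simp only [Fin.append_left, Fin.append_right, hwj, decide_false, Bool.false_and, ind_false,
    zero_add]
  rfl

/-- In `𝔽₂`, `x + y = 0 ⇒ y = x`. [folklore] -/
theorem eq_of_add_eq_zero : ∀ x y : ZMod 2, x + y = 0 → y = x := by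
  decide

/-- **THEOREM K3-INV (every K-model over a 3-bit base with an involution pencil is empty, census-free,
for every `p`).** `π(ū,s) = (ū, p(ū) ⊕ K(ū)s)` on `𝔽₂^{3+m}`, `K(ū)` additive involutions, `K(0̄) = id`,
`K(w₆)∘⋯∘K(w₀) = id` for nonzero `w₀..w₆` (automatic for involution pencils: any enumeration of
`𝔽₂³ ∖ 0`); residual `[ū = 0̄]·V(s)` with `T_V(a) = 1` for some direction triple `a` (every
codimension-3 flat).  Then no cubic pair `c₁ ⊕ c₂∘π` has that residual. [folklore] -/
theorem kthree_inv_empty {m : ℕ} (K : (Fin 3 → Bool) → (Fin m → Bool) → (Fin m → Bool))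
    (hKadd : ∀ u s t, K u (bxor s t) = bxor (K u s) (K u t)) (hK0 : ∀ s, K (fun _ => false) s = s)
    (hKinv : ∀ u s, K u (K u s) = s) (w : ℕ → (Fin 3 → Bool)) (hw : ∀ k, k ≤ 6 → w k ≠ fun _ => false)
    (hprod : ∀ s, K (w 6) (K (w 5) (K (w 4) (K (w 3) (K (w 2) (K (w 1) (K (w 0) s)))))) = s)
    (p : (Fin 3 → Bool) → (Fin m → Bool)) (π : (Fin (3 + m) → Bool) → (Fin (3 + m) → Bool))
    (hπ : ∀ u s, π (Fin.append u s) = Fin.append u (bxor (p u) (K u s)))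
    (V : (Fin m → Bool) → Bool)
    (hV : ∃ a : Fin 3 → Fin m → Bool,
      ∑ ε : Fin 3 → Bool, ind (V fun l => decide (Odd #(univ.filter fun i => ε i && a i l))) = 1)
    (c₁ c₂ : (Fin (3 + m) → Bool) → Bool) (h₁ : IsDegLeFun 3 c₁) (h₂ : IsDegLeFun 3 c₂)
    (hres : ∀ z, (c₁ z ^^ c₂ (π z)) =
      (decide (∀ i : Fin 3, z (Fin.castAdd m i) = false) && V (fun k => z (Fin.natAdd 3 k)))) :
    False := by
  by_cases hinv : ∀ (u : Fin 3 → Bool) (a : Fin 3 → Fin m → Bool),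
      ∑ ε : Fin 3 → Bool, ind (V fun l => decide (Odd #(univ.filter fun i => ε i && K u (a i) l))) =
        ∑ ε : Fin 3 → Bool, ind (V fun l => decide (Odd #(univ.filter fun i => ε i && a i l)))
  · -- invariant case: the chain of length 7 along the relation weighs `7 · T_V(a) = 1`
    obtain ⟨a, ha⟩ := hV
    have hconst : ∀ k, ∑ ε : Fin 3 → Bool, ind (V fun l => decide (Odd #(univ.filter fun i => ε i &&
        (Nat.rec (motive := fun _ => Fin 3 → Fin m → Bool) a (fun k t i => K (w k) (t i)) k) i l))) = 1 := by
      intro k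
      induction k with
      | zero => exact ha
      | succ k ih => simp only [hinv]; exact ih
    have h := kthree_chain K hKadd hK0 p π hπ V c₁ c₂ h₁ h₂ hres 6 w hw
      (fun k => Nat.rec (motive := fun _ => Fin 3 → Fin m → Bool) a (fun k t i => K (w k) (t i)) k)
      (fun _ _ => rfl) (funext fun i => hprod (a i))
    simp only [hconst, sum_const, card_univ, Fintype.card_fin] at h
    exact absurd h (by decide)
  · -- some involution `K(ū)` moves `T_V`: the chain of length 2 weighs `T_V(τ) + T_V(K(ū)τ) = 1`
    push Not at hinv
    obtain ⟨u, a, hne⟩ := hinv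
    have hu : u ≠ fun _ => false := by
      rintro rfl
      simp only [hK0] at hne
      exact hne rfl
    have h := kthree_chain K hKadd hK0 p π hπ V c₁ c₂ h₁ h₂ hres 1 (fun _ => u) (fun _ _ => hu)
      (fun k => Nat.rec (motive := fun _ => Fin 3 → Fin m → Bool) a (fun _ t i => K u (t i)) k)
      (fun _ _ => rfl) (funext fun i => hKinv u (a i))
    rw [Fin.sum_univ_two] at h
    exact hne (eq_of_add_eq_zero _ _ h)

end Summit.QuantumAdvantage.QuantumAdvantage.Theorems.NearExactIsExact.Negative.KThreeInvolution
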